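import Mathlib
import HarnessLib
import Literature.Analysis.FluidPDE.KochTataru
import Literature.Analysis.FluidPDE.KochTataruKernel
import Literature.Analysis.FluidPDE.KochTataruPointwise
import Literature.Analysis.FluidPDE.OseenSlice
import Literature.Analysis.FluidPDE.KNSSMildDecayHorizontal
import Literature.Analysis.FluidPDE.NSBoundedMildOseenRestart
import Literature.Analysis.FluidPDE.UlocKernelEstimates
import Summits.NavierStokesRegularity.NavierStokesRegularity.Theorems.ThreadingFluxPoloidalLiouvillePrecessionOseenTimeLipschitz

/-!
# Route `ThreadingFlux`, item `PoloidalLiouville` (W1, stmt-NavierStokesRegularity-1222) — crux idea «precession-gap» (ns-idea-15,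
# `Cruxes/PoloidalLiouville/PrecessionSketch.lean`), analysis lemma D `ShortPeriodCollapse`, KERNEL STEP: slice bounds of the Oseen kernel against
# a PAIR of bounded fields at distance `W` — `‖∫K(σ,x−y)([a′,a′] − [a,a])dy‖ ≤ 2C₁σ^{-1/2}·B·W` and, for two kernel times `θ ≤ θ′`,
# `‖∫(K(θ′,x−y) − K(θ,x−y))([a′,a′] − [a,a])dy‖ ≤ 18·C_L(θ′−θ)θ^{-3/2}·B·W`

Cell ns-regularity-ideate, seat ns-poloidal-K2-p2 g13 (hand for the precession rungs after F/G/P1/P3, DIRECTOR-NS #264/#267/#270/#272).  Helper file (no stub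
closed here) for D `ShortPeriodCollapse` («an honest Oseen-mild bounded time-periodic solution with `P‖u‖²_∞ ≤ c₀` is steady»): the two slice estimates that
make the period-mean-free part CONTRACT.  With `a′ = u(τ+h,·)`, `a = u(τ,·)`, `‖a‖,‖a′‖ ≤ B`, `‖a′ − a‖ ≤ W`:

* `norm_integral_oseenKernel_pair_sub_le` (near period): from the tree's pointwise bound `‖K(σ,z)[p,q]‖ ≤ C₀(σ+‖z‖²)^{-2}‖p‖‖q‖`
  (`Literature.Analysis.FluidPDE.exists_norm_oseenKernel_three_le`) and `∫(σ+‖z‖²)^{-2} = M₀σ^{-1/2}`, via `[a′,a′] − [a,a] = [a′,a′−a] + [a′−a,a]`;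
* `norm_integral_oseenKernel_tdiff_pair_sub_le` (far periods): the same algebra against the TIME DIFFERENCE of the kernel, whose `L¹` size is P1
  `…PrecessionOseenTimeLipschitz.oseenKernelTimeLipschitzL1` (`∫‖K(θ′,z)[p,q] − K(θ,z)[p,q]‖dz ≤ C_L(θ′−θ)θ^{-3/2}‖p‖‖q‖`, p678537); since P1 is stated for
  CONSTANT vectors, the pointwise majorant for variable fields is obtained by expanding `p, q` in the standard basis
  (`oseenKernel_eq_sum_basis`: `K[p,q] = Σ_{ij} p_i q_j K[e_i,e_j]`, bilinearity through `Literature.Analysis.FluidPDE.oseenKernelCLM`), giving the majorant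
  `m(z) = Σ_{ij}‖K(θ′,z)[e_i,e_j] − K(θ,z)[e_i,e_j]‖` with `∫m ≤ 9C_L(θ′−θ)θ^{-3/2}` (`norm_oseenKernel_tdiff_le_majorant`, `integral_tdiffMajorant_le`).

WHAT THIS IS NOT: not D, not the rung F; items 1222 / 27585 OPEN; no claim about Navier–Stokes regularity.
-/

noncomputable section

-- the summit and its single sub-problem share the name (CONVENTIONS §1), as in every Theorems file
set_option linter.dupNamespace false

namespace Summit.NavierStokesRegularity.NavierStokesRegularity.Theorems.ThreadingFluxPoloidalLiouvillePrecessionShortPeriodKernel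

open MeasureTheory Set Function Filter Topology
open scoped RealInnerProductSpace ENNReal
open Literature.Analysis Literature.Analysis.FluidPDE Literature.Analysis.UnboundedOperators
open Summit.NavierStokesRegularity.NavierStokesRegularity.Theorems.ThreadingFluxPoloidalLiouvillePrecessionOseenTimeLipschitz

/-! ## Bilinear algebra of the kernel -/

/-- `K[a′,a′] − K[a,a] = K[a′, a′−a] + K[a′−a, a]` (bilinearity of the Oseen kernel). [folklore] -/
theorem oseenKernel_pair_sub (σ : ℝ) (z a a' : EuclideanSpace ℝ (Fin 3)) :
    oseenKernel σ z a' a' - oseenKernel σ z a a = oseenKernel σ z a' (a' - a) + oseenKernel σ z (a' - a) a := by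
  rw [oseenKernel_sub_right, oseenKernel_sub_left]
  abel

/-- **Basis expansion of the kernel**: `K(σ,z)[a,b] = Σ_i Σ_j (a_i b_j) • K(σ,z)[e_i,e_j]`. [folklore] -/
theorem oseenKernel_eq_sum_basis (σ : ℝ) (z a b : EuclideanSpace ℝ (Fin 3)) :
    oseenKernel σ z a b = ∑ i, ∑ j, (a i * b j) •
      oseenKernel σ z (EuclideanSpace.single i (1 : ℝ)) (EuclideanSpace.single j (1 : ℝ)) := by
  have ha : a = ∑ i, a i • EuclideanSpace.single i (1 : ℝ) := by
    conv_lhs => rw [← (EuclideanSpace.basisFun (Fin 3) ℝ).sum_repr a]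
    simp only [EuclideanSpace.basisFun_repr, EuclideanSpace.basisFun_apply]
  have hb : b = ∑ j, b j • EuclideanSpace.single j (1 : ℝ) := by
    conv_lhs => rw [← (EuclideanSpace.basisFun (Fin 3) ℝ).sum_repr b]
    simp only [EuclideanSpace.basisFun_repr, EuclideanSpace.basisFun_apply]
  conv_lhs => rw [← oseenKernelCLM_apply, ha, hb]
  simp only [map_sum, map_smul, FunLike.coe_sum, FunLike.coe_smul, Finset.sum_apply,
    Pi.smul_apply, oseenKernelCLM_apply, smul_smul, Finset.smul_sum]
  rw [Finset.sum_comm]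
  refine Finset.sum_congr rfl fun i _ => Finset.sum_congr rfl fun j _ => ?_
  rw [mul_comm]

/-! ## The time-difference majorant -/

/-- **Pointwise time-difference majorant**: `‖K(θ′,z)[a,b] − K(θ,z)[a,b]‖ ≤ m(z)‖a‖‖b‖` with
`m(z) = Σ_{ij}‖K(θ′,z)[e_i,e_j] − K(θ,z)[e_i,e_j]‖`. [folklore] -/
theorem norm_oseenKernel_tdiff_le_majorant (θ θ' : ℝ) (z a b : EuclideanSpace ℝ (Fin 3)) :
    ‖oseenKernel θ' z a b - oseenKernel θ z a b‖ ≤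
      (∑ i : Fin 3, ∑ j : Fin 3, ‖oseenKernel θ' z (EuclideanSpace.single i (1 : ℝ)) (EuclideanSpace.single j (1 : ℝ)) -
        oseenKernel θ z (EuclideanSpace.single i (1 : ℝ)) (EuclideanSpace.single j (1 : ℝ))‖) * ‖a‖ * ‖b‖ := by
  rw [oseenKernel_eq_sum_basis θ', oseenKernel_eq_sum_basis θ, ← Finset.sum_sub_distrib]
  simp_rw [← Finset.sum_sub_distrib, ← smul_sub]
  rw [Finset.sum_mul, Finset.sum_mul]
  refine (norm_sum_le _ _).trans (Finset.sum_le_sum fun i _ => ?_)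
  rw [Finset.sum_mul, Finset.sum_mul]
  refine (norm_sum_le _ _).trans (Finset.sum_le_sum fun j _ => ?_)
  rw [norm_smul]
  have hai : ‖a i‖ ≤ ‖a‖ := PiLp.norm_apply_le a i
  have hbj : ‖b j‖ ≤ ‖b‖ := PiLp.norm_apply_le b j
  have h1 : ‖a i * b j‖ ≤ ‖a‖ * ‖b‖ := by
    rw [norm_mul]; exact mul_le_mul hai hbj (norm_nonneg _) (norm_nonneg _)
  calc ‖a i * b j‖ * ‖_‖ ≤ (‖a‖ * ‖b‖) * ‖_‖ := mul_le_mul_of_nonneg_right h1 (norm_nonneg _)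
    _ = _ := by ring

/-- **Integrability and `L¹` size of the time-difference majorant**: `∫ m ≤ 9·C_L(θ′−θ)θ^{-3/2}` (P1 applied to the nine unit pairs `(e_i,e_j)`). [folklore] -/
theorem integral_tdiffMajorant_le {C_L : ℝ}
    (hP1 : ∀ θ θ' : ℝ, 0 < θ → θ ≤ θ' → ∀ a b : EuclideanSpace ℝ (Fin 3),
      ∫ z, ‖oseenKernel θ' z a b - oseenKernel θ z a b‖ ≤ C_L * (θ' - θ) * θ ^ (-(3 / 2 : ℝ)) * ‖a‖ * ‖b‖)
    {θ θ' : ℝ} (hθ : 0 < θ) (hθθ' : θ ≤ θ') :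
    Integrable (fun z : EuclideanSpace ℝ (Fin 3) => ∑ i : Fin 3, ∑ j : Fin 3,
        ‖oseenKernel θ' z (EuclideanSpace.single i (1 : ℝ)) (EuclideanSpace.single j (1 : ℝ)) -
          oseenKernel θ z (EuclideanSpace.single i (1 : ℝ)) (EuclideanSpace.single j (1 : ℝ))‖) ∧
      ∫ z : EuclideanSpace ℝ (Fin 3), ∑ i : Fin 3, ∑ j : Fin 3,
        ‖oseenKernel θ' z (EuclideanSpace.single i (1 : ℝ)) (EuclideanSpace.single j (1 : ℝ)) -
          oseenKernel θ z (EuclideanSpace.single i (1 : ℝ)) (EuclideanSpace.single j (1 : ℝ))‖ ≤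
        9 * C_L * (θ' - θ) * θ ^ (-(3 / 2 : ℝ)) := by
  have hθ' : 0 < θ' := hθ.trans_le hθθ'
  obtain ⟨C, -, hK⟩ := exists_lintegral_enorm_oseenKernel_le (E := EuclideanSpace ℝ (Fin 3))
  have hint : ∀ i j : Fin 3, Integrable (fun z : EuclideanSpace ℝ (Fin 3) =>
      ‖oseenKernel θ' z (EuclideanSpace.single i (1 : ℝ)) (EuclideanSpace.single j (1 : ℝ)) -
        oseenKernel θ z (EuclideanSpace.single i (1 : ℝ)) (EuclideanSpace.single j (1 : ℝ))‖) := fun i j =>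
    ((hK hθ' _ _).1.sub (hK hθ _ _).1).norm
  refine ⟨integrable_finsetSum _ fun i _ => integrable_finsetSum _ fun j _ => hint i j, ?_⟩
  rw [integral_finsetSum _ fun i _ => integrable_finsetSum _ fun j _ => hint i j]
  have hone : ∀ i : Fin 3, ‖EuclideanSpace.single i (1 : ℝ)‖ = 1 := fun i => by simp
  have hterm : ∀ i j : Fin 3, ∫ z : EuclideanSpace ℝ (Fin 3),
      ‖oseenKernel θ' z (EuclideanSpace.single i (1 : ℝ)) (EuclideanSpace.single j (1 : ℝ)) -
        oseenKernel θ z (EuclideanSpace.single i (1 : ℝ)) (EuclideanSpace.single j (1 : ℝ))‖ ≤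
      C_L * (θ' - θ) * θ ^ (-(3 / 2 : ℝ)) := fun i j => by
    have h := hP1 θ θ' hθ hθθ' (EuclideanSpace.single i (1 : ℝ)) (EuclideanSpace.single j (1 : ℝ))
    rwa [hone i, hone j, mul_one, mul_one] at h
  calc ∑ i : Fin 3, ∫ z : EuclideanSpace ℝ (Fin 3), ∑ j : Fin 3,
        ‖oseenKernel θ' z (EuclideanSpace.single i (1 : ℝ)) (EuclideanSpace.single j (1 : ℝ)) -
          oseenKernel θ z (EuclideanSpace.single i (1 : ℝ)) (EuclideanSpace.single j (1 : ℝ))‖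
      = ∑ i : Fin 3, ∑ j : Fin 3, ∫ z : EuclideanSpace ℝ (Fin 3),
        ‖oseenKernel θ' z (EuclideanSpace.single i (1 : ℝ)) (EuclideanSpace.single j (1 : ℝ)) -
          oseenKernel θ z (EuclideanSpace.single i (1 : ℝ)) (EuclideanSpace.single j (1 : ℝ))‖ :=
        Finset.sum_congr rfl fun i _ => integral_finsetSum _ fun j _ => hint i j
    _ ≤ ∑ _i : Fin 3, ∑ _j : Fin 3, C_L * (θ' - θ) * θ ^ (-(3 / 2 : ℝ)) :=
        Finset.sum_le_sum fun i _ => Finset.sum_le_sum fun j _ => hterm i j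
    _ = 9 * C_L * (θ' - θ) * θ ^ (-(3 / 2 : ℝ)) := by simp; ring

/-! ## Slice estimates against a pair of bounded fields -/

/-- **Far-period slice estimate**: for `0 < θ ≤ θ′`, fields `a, a′` bounded by `B` with `‖a′ − a‖ ≤ W` (a.e.-measurable), and every `x`,
`‖(∫K(θ′,x−y)[a′,a′] − ∫K(θ,x−y)[a′,a′]) − (∫K(θ′,x−y)[a,a] − ∫K(θ,x−y)[a,a])‖ ≤ 18·C_L(θ′−θ)θ^{-3/2}·B·W`. [folklore] -/
theorem norm_integral_oseenKernel_tdiff_pair_sub_le {C_L : ℝ}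
    (hP1 : ∀ θ θ' : ℝ, 0 < θ → θ ≤ θ' → ∀ a b : EuclideanSpace ℝ (Fin 3),
      ∫ z, ‖oseenKernel θ' z a b - oseenKernel θ z a b‖ ≤ C_L * (θ' - θ) * θ ^ (-(3 / 2 : ℝ)) * ‖a‖ * ‖b‖)
    {θ θ' : ℝ} (hθ : 0 < θ) (hθθ' : θ ≤ θ') {B W : ℝ} (hB : 0 ≤ B) (hW : 0 ≤ W)
    {a a' : EuclideanSpace ℝ (Fin 3) → EuclideanSpace ℝ (Fin 3)} (ham : AEMeasurable a volume) (ha'm : AEMeasurable a' volume)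
    (ha : ∀ y, ‖a y‖ ≤ B) (ha' : ∀ y, ‖a' y‖ ≤ B) (hw : ∀ y, ‖a' y - a y‖ ≤ W) (x : EuclideanSpace ℝ (Fin 3)) :
    ‖((∫ y, oseenKernel θ' (x - y) (a' y) (a' y)) - ∫ y, oseenKernel θ (x - y) (a' y) (a' y)) -
        ((∫ y, oseenKernel θ' (x - y) (a y) (a y)) - ∫ y, oseenKernel θ (x - y) (a y) (a y))‖ ≤
      18 * C_L * (θ' - θ) * θ ^ (-(3 / 2 : ℝ)) * B * W := by
  have hθ' : 0 < θ' := hθ.trans_le hθθ'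
  set m : EuclideanSpace ℝ (Fin 3) → ℝ := fun z => ∑ i : Fin 3, ∑ j : Fin 3,
      ‖oseenKernel θ' z (EuclideanSpace.single i (1 : ℝ)) (EuclideanSpace.single j (1 : ℝ)) -
        oseenKernel θ z (EuclideanSpace.single i (1 : ℝ)) (EuclideanSpace.single j (1 : ℝ))‖ with hm
  obtain ⟨hmi, hmle⟩ := integral_tdiffMajorant_le hP1 hθ hθθ'
  have hi1 := integrable_oseenKernel_comp_sub_of_bound hθ' ha'm ha'm ha' ha' x
  have hi2 := integrable_oseenKernel_comp_sub_of_bound hθ ha'm ha'm ha' ha' x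
  have hi3 := integrable_oseenKernel_comp_sub_of_bound hθ' ham ham ha ha x
  have hi4 := integrable_oseenKernel_comp_sub_of_bound hθ ham ham ha ha x
  have hA : Integrable (fun y => oseenKernel θ' (x - y) (a' y) (a' y) - oseenKernel θ (x - y) (a' y) (a' y)) := hi1.sub hi2
  have hB' : Integrable (fun y => oseenKernel θ' (x - y) (a y) (a y) - oseenKernel θ (x - y) (a y) (a y)) := hi3.sub hi4
  rw [← integral_sub hi1 hi2, ← integral_sub hi3 hi4, ← integral_sub hA hB']
  have hpt : ∀ y, ‖(oseenKernel θ' (x - y) (a' y) (a' y) - oseenKernel θ (x - y) (a' y) (a' y)) -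
      (oseenKernel θ' (x - y) (a y) (a y) - oseenKernel θ (x - y) (a y) (a y))‖ ≤ (2 * B * W) * m (x - y) := by
    intro y
    have halg : (oseenKernel θ' (x - y) (a' y) (a' y) - oseenKernel θ (x - y) (a' y) (a' y)) -
        (oseenKernel θ' (x - y) (a y) (a y) - oseenKernel θ (x - y) (a y) (a y)) =
        (oseenKernel θ' (x - y) (a' y) (a' y - a y) - oseenKernel θ (x - y) (a' y) (a' y - a y)) +
        (oseenKernel θ' (x - y) (a' y - a y) (a y) - oseenKernel θ (x - y) (a' y - a y) (a y)) := by
      rw [oseenKernel_sub_right, oseenKernel_sub_left, oseenKernel_sub_right, oseenKernel_sub_left]; abel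
    rw [halg]
    refine (norm_add_le _ _).trans ?_
    have h1 := norm_oseenKernel_tdiff_le_majorant θ θ' (x - y) (a' y) (a' y - a y)
    have h2 := norm_oseenKernel_tdiff_le_majorant θ θ' (x - y) (a' y - a y) (a y)
    have hm0 : 0 ≤ m (x - y) := Finset.sum_nonneg fun i _ => Finset.sum_nonneg fun j _ => norm_nonneg _
    have e1 : m (x - y) * ‖a' y‖ * ‖a' y - a y‖ ≤ m (x - y) * B * W := by gcongr; exacts [ha' y, hw y]
    have e2 : m (x - y) * ‖a' y - a y‖ * ‖a y‖ ≤ m (x - y) * W * B := by gcongr; exacts [hw y, ha y]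
    calc _ ≤ m (x - y) * ‖a' y‖ * ‖a' y - a y‖ + m (x - y) * ‖a' y - a y‖ * ‖a y‖ := add_le_add h1 h2
      _ ≤ m (x - y) * B * W + m (x - y) * W * B := add_le_add e1 e2
      _ = (2 * B * W) * m (x - y) := by ring
  have hmint : Integrable (fun y => (2 * B * W) * m (x - y)) := (hmi.comp_sub_left x).const_mul _
  calc _ ≤ ∫ y, (2 * B * W) * m (x - y) := norm_integral_le_of_norm_le hmint (Eventually.of_forall hpt)
    _ = (2 * B * W) * ∫ z, m z := by rw [integral_const_mul, integral_sub_left_eq_self m volume x]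
    _ ≤ (2 * B * W) * (9 * C_L * (θ' - θ) * θ ^ (-(3 / 2 : ℝ))) := mul_le_mul_of_nonneg_left hmle (by positivity)
    _ = 18 * C_L * (θ' - θ) * θ ^ (-(3 / 2 : ℝ)) * B * W := by ring

/-- **Near-period slice estimate**: with the pointwise kernel constant `C₀` and `M₀ = ∫(1+‖w‖²)^{-2}`,
`‖∫K(σ,x−y)[a′,a′]dy − ∫K(σ,x−y)[a,a]dy‖ ≤ 2C₀M₀σ^{-1/2}·B·W` for fields `a, a′` bounded by `B` at distance `W`. [folklore] -/
theorem norm_integral_oseenKernel_pair_sub_le {C₀ : ℝ} (hC₀ : 0 ≤ C₀)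
    (hK : ∀ ⦃σ : ℝ⦄, 0 < σ → ∀ z a b : EuclideanSpace ℝ (Fin 3),
      ‖oseenKernel σ z a b‖ ≤ C₀ * (σ + ‖z‖ ^ 2) ^ (-(2 : ℝ)) * ‖a‖ * ‖b‖)
    {σ : ℝ} (hσ : 0 < σ) {B W : ℝ} (hB : 0 ≤ B) (hW : 0 ≤ W)
    {a a' : EuclideanSpace ℝ (Fin 3) → EuclideanSpace ℝ (Fin 3)} (ham : AEMeasurable a volume) (ha'm : AEMeasurable a' volume)
    (ha : ∀ y, ‖a y‖ ≤ B) (ha' : ∀ y, ‖a' y‖ ≤ B) (hw : ∀ y, ‖a' y - a y‖ ≤ W) (x : EuclideanSpace ℝ (Fin 3)) :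
    ‖(∫ y, oseenKernel σ (x - y) (a' y) (a' y)) - ∫ y, oseenKernel σ (x - y) (a y) (a y)‖ ≤
      2 * C₀ * (∫ w : EuclideanSpace ℝ (Fin 3), (1 + ‖w‖ ^ 2) ^ (-(2 : ℝ))) * σ ^ (-(1 / 2 : ℝ)) * B * W := by
  set M₀ : ℝ := ∫ w : EuclideanSpace ℝ (Fin 3), (1 + ‖w‖ ^ 2) ^ (-(2 : ℝ)) with hM₀
  have he : (Module.finrank ℝ (EuclideanSpace ℝ (Fin 3)) : ℝ) < 2 * 2 := by
    rw [finrank_real_euclideanSpace_fin_three]; norm_num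
  have hM₀pos : 0 < M₀ := integral_one_add_norm_sq_rpow_neg_pos he
  have hi1 := integrable_oseenKernel_comp_sub_of_bound hσ ha'm ha'm ha' ha' x
  have hi2 := integrable_oseenKernel_comp_sub_of_bound hσ ham ham ha ha x
  rw [← integral_sub hi1 hi2]
  set k : EuclideanSpace ℝ (Fin 3) → ℝ := fun z => (σ + ‖z‖ ^ 2) ^ (-(2 : ℝ)) with hk
  have hkint : Integrable k := integrable_add_norm_sq_rpow_neg he hσ
  have hkI : ∫ z, k z = σ ^ (-(1 / 2 : ℝ)) * M₀ := by
    rw [hk, hM₀]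
    dsimp only
    rw [integral_add_norm_sq_rpow_neg hσ, finrank_real_euclideanSpace_fin_three]
    norm_num
  have hpt : ∀ y, ‖oseenKernel σ (x - y) (a' y) (a' y) - oseenKernel σ (x - y) (a y) (a y)‖ ≤ (2 * C₀ * B * W) * k (x - y) := by
    intro y
    rw [oseenKernel_pair_sub]
    refine (norm_add_le _ _).trans ?_
    have hk0 : 0 ≤ k (x - y) := Real.rpow_nonneg (by positivity) _
    have h1 := hK hσ (x - y) (a' y) (a' y - a y)
    have h2 := hK hσ (x - y) (a' y - a y) (a y)
    have e1 : C₀ * k (x - y) * ‖a' y‖ * ‖a' y - a y‖ ≤ C₀ * k (x - y) * B * W := by gcongr; exacts [ha' y, hw y]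
    have e2 : C₀ * k (x - y) * ‖a' y - a y‖ * ‖a y‖ ≤ C₀ * k (x - y) * W * B := by gcongr; exacts [hw y, ha y]
    calc _ ≤ C₀ * k (x - y) * ‖a' y‖ * ‖a' y - a y‖ + C₀ * k (x - y) * ‖a' y - a y‖ * ‖a y‖ := add_le_add h1 h2
      _ ≤ C₀ * k (x - y) * B * W + C₀ * k (x - y) * W * B := add_le_add e1 e2
      _ = (2 * C₀ * B * W) * k (x - y) := by ring
  have hbint : Integrable (fun y => (2 * C₀ * B * W) * k (x - y)) := (hkint.comp_sub_left x).const_mul _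
  calc _ ≤ ∫ y, (2 * C₀ * B * W) * k (x - y) := norm_integral_le_of_norm_le hbint (Eventually.of_forall hpt)
    _ = (2 * C₀ * B * W) * ∫ z, k z := by rw [integral_const_mul, integral_sub_left_eq_self k volume x]
    _ = 2 * C₀ * M₀ * σ ^ (-(1 / 2 : ℝ)) * B * W := by rw [hkI]; ring

end Summit.NavierStokesRegularity.NavierStokesRegularity.Theorems.ThreadingFluxPoloidalLiouvillePrecessionShortPeriodKernel

end
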